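import Summits.CriticalPhenomena.PercolationContinuityZ3.Theses.PercRayRenewal
import Literature.Probability.Percolation.MeanFieldBetaFromGamma
import HarnessLib

/-!
# Strategist s1 — typed signatures for the STRATEGY-CENSUS of
# `PercRayRenewal.JumpLineAvoidanceDecay` (stmt-CriticalPhenomena-4626)

Definitions only (no `sorry`): the strengthenings, split pieces and glue targets discussed in
`STRATEGY-CENSUS.md`.  Nothing here is a route item; this file is scratch evidence.
-/

noncomputable section

namespace Summit.CriticalPhenomena.PercolationContinuityZ3.Cruxes.JumpLineAvoidanceDecay.Strategist

open Literature.Probability.Percolation Literature.Probability.LatticeModels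

/-- The jump hypothesis `θ(p_c(ℤ³)) > 0`. -/
def Jump : Prop := 0 < theta (zdGraph 3) 0 (criticalProbI 3)

/-- Truncated one-arm event `{0 ↔ ∂Λ_n} ∖ {0 ↔ ∞}` (the event of crux G1′). -/
def truncArm (n : ℕ) : Set (BondConfig (Site 3)) := siteToBoundary 3 n \ percolatesAt 0

/-- Finite-cluster volume tail event `D_n = {n ≤ |C(0)| < ∞}`. -/
def finTail (n : ℕ) : Set (BondConfig (Site 3)) := clusterSizeGe (0 : Site 3) n \ percolatesAt 0

/-! ## Strengthen -/

/-- **S⁺ = U_rad** (uniform supercritical truncated one-arm decay): the Grimmett–Marstrand /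
CCGKS finite-radius tail of the supercritical phase with constants that do not degenerate as
`p ↓ p_c`.  Unconditional (no jump hypothesis); implies G via right-continuity; plausibly TRUE in
the continuous world as well (`π^f_n(p) ≤ P_{p_c}(0 ↔ ∂Λ_n)`-type heuristics), unlike lead c6's
line-avoidance uniformity `U` which implies the jump. -/
def UniformSupercriticalTruncArmDecay : Prop :=
  ∃ σ C : ℝ, 0 < σ ∧ ∀ p : unitInterval, criticalProbI 3 < p → ∀ n : ℕ, 1 ≤ n →
    (bondPercolation (zdGraph 3) p).real (truncArm n) ≤ C * (n : ℝ) ^ (-σ)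

/-- **S⁺_≥** (volume currency, `p ≥ p_c`): `sup_{p ≥ p_c} P_p(n ≤ |C| < ∞) ≤ C n^{-κ}`. -/
def UniformSupercriticalVolumeTail : Prop :=
  ∃ κ C : ℝ, 0 < κ ∧ ∀ p : unitInterval, criticalProbI 3 ≤ p → ∀ n : ℕ, 1 ≤ n →
    (bondPercolation (zdGraph 3) p).real (finTail n) ≤ C * (n : ℝ) ^ (-κ)

/-- **S⁺_all** (sup over ALL `p ∈ [0,1]`): summit-strength — by left-continuity of
`p ↦ P_p(|C| ≥ n)` and `θ ≡ 0` on `[0, p_c)` it gives `θ(p_c) ≤ C n^{-κ}` for every `n`. REJECTED. -/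
def AllParameterVolumeTail : Prop :=
  ∃ κ C : ℝ, 0 < κ ∧ ∀ p : unitInterval, ∀ n : ℕ, 1 ≤ n →
    (bondPercolation (zdGraph 3) p).real (finTail n) ≤ C * (n : ℝ) ^ (-κ)

/-- Sanity: S⁺_all ⇒ S⁺_≥ (trivial specialisation). -/
theorem uniformSupercriticalVolumeTail_of_all :
    AllParameterVolumeTail → UniformSupercriticalVolumeTail := by
  rintro ⟨κ, C, hκ, h⟩
  exact ⟨κ, C, hκ, fun p _ n hn => h p n hn⟩

/-! ## Decomposition (α): G1′ ⟸ H ∧ PolyQGM -/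

/-- **H** — right-Hölder continuity of `θ` at `p_c` (unconditional):
`θ(p) − θ(p_c) ≤ C (p − p_c)^b` for `p_c ≤ p < p_c + δ₀`. -/
def RightHolderTheta : Prop :=
  ∃ b C δ₀ : ℝ, 0 < b ∧ 0 < δ₀ ∧ ∀ p : unitInterval, criticalProbI 3 ≤ p →
    (p : ℝ) - criticalProb (zdGraph 3) 0 < δ₀ →
      theta (zdGraph 3) 0 p - theta (zdGraph 3) 0 (criticalProbI 3) ≤
        C * ((p : ℝ) - criticalProb (zdGraph 3) 0) ^ b

/-- **PolyQGM_rad** — polynomial quantitative Grimmett–Marstrand for the truncated one-arm: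
`P_p(0 ↔ ∂Λ_n, 0 ↮ ∞) ≤ C (p − p_c)^{-A} n^{-σ}` for `p_c < p < p_c + δ₀`.
(DKT 2020 give only `ξ_p ≤ exp(C (p − p_c)^{-2})`; the polynomial form is their stated open
intermediate problem, arXiv:1902.03207 p. 4.) -/
def PolyQuantGMTruncArm : Prop :=
  ∃ A σ C δ₀ : ℝ, 0 < σ ∧ 0 < δ₀ ∧ ∀ p : unitInterval, criticalProbI 3 < p →
    (p : ℝ) - criticalProb (zdGraph 3) 0 < δ₀ → ∀ n : ℕ, 1 ≤ n →
      (bondPercolation (zdGraph 3) p).real (truncArm n) ≤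
        C * ((p : ℝ) - criticalProb (zdGraph 3) 0) ^ (-A) * (n : ℝ) ^ (-σ)

/-- The glue of split (α), believed provable now (monotone coupling of `{0 ↔ ∂Λ_n}` +
exponent arithmetic with `δ = n^{-σ/(A+b)}`): `H → PolyQGM_rad → G1′` — NOTE the jump hypothesis
of G1′ is not even used, and there is no `b > A` constraint (contrast lead c6's (f′)). -/
def AlphaGlue : Prop :=
  RightHolderTheta → PolyQuantGMTruncArm →
    Summit.CriticalPhenomena.PercolationContinuityZ3.Theses.PercRayRenewal.JumpTruncatedOneArmDecay

/-- **Entropic modulus bound** (Dewan–Muirhead / Hutchcroft 2022 Thm 4.1 shape; the tree has the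
machinery in `Literature/Probability/Percolation/HutchcroftVolumeTail.lean`, `kl_run_eq`,
`sq_sub_le_two_mul_kl_mul_max`): the right modulus of `θ` at `p_c` is the critical finite-cluster
tail up to `K (p − p_c) √n`.  This is why H is G1′-hard: every handle on H is a rate for
`P_{p_c}(n ≤ |C| < ∞)`. -/
def EntropicModulusBound : Prop :=
  ∃ K : ℝ, ∀ p : unitInterval, criticalProbI 3 ≤ p → ∀ n : ℕ, 1 ≤ n →
    theta (zdGraph 3) 0 p - theta (zdGraph 3) 0 (criticalProbI 3) ≤
      (bondPercolation (zdGraph 3) (criticalProbI 3)).real (finTail n) +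
        K * ((p : ℝ) - criticalProb (zdGraph 3) 0) * Real.sqrt n

/-! ## Decomposition (D3): contact deficit ∧ two-ghost MTP -/

/-- Contacts of `C(0)` with the infinite cluster: lattice edges `(u, v)` with `u ∈ C(0)`,
`u ~ v`, `|C(v)| = ∞` (necessarily closed when `C(0)` is finite). -/
def contactSet (ω : BondConfig (Site 3)) : Set (Site 3 × Site 3) :=
  {e | e.1 ∈ openCluster ω 0 ∧ (zdGraph 3).Adj e.1 e.2 ∧ (openCluster ω e.2).Infinite}

/-- **CD** (contact deficit, the open half): in the jump world, large finite clusters with fewer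
than `|C|^{1/2+ε}` contacts are polynomially rare. -/
def ContactDeficitBound : Prop :=
  Jump → ∃ ε κ C : ℝ, 0 < ε ∧ 0 < κ ∧ ∀ n : ℕ, 1 ≤ n →
    (bondPercolation (zdGraph 3) (criticalProbI 3)).real
      {ω | ω ∈ finTail n ∧
        ((contactSet ω).ncard : ℝ) < ((openCluster ω 0).ncard : ℝ) ^ ((1 : ℝ) / 2 + ε)}
      ≤ C * (n : ℝ) ^ (-κ)

/-- **Contact-rich tail** (the half believed provable from the two-ghost corollary
`Literature.Probability.Percolation.Hutchcroft2020_twoGhost_corollary` by the mass transport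
`f(u,v) = 1{v ∈ C(u), |C(u)| < ∞} · #contacts(v) / |C(u)|` and a dyadic decomposition):
large finite clusters with at least `|C|^{1/2+ε}` contacts have probability `≤ C n^{-ε}`. -/
def ContactRichTail : Prop :=
  ∀ ε : ℝ, 0 < ε → ∃ C : ℝ, ∀ n : ℕ, 1 ≤ n →
    (bondPercolation (zdGraph 3) (criticalProbI 3)).real
      {ω | ω ∈ finTail n ∧
        ((openCluster ω 0).ncard : ℝ) ^ ((1 : ℝ) / 2 + ε) ≤ ((contactSet ω).ncard : ℝ)}
      ≤ C * (n : ℝ) ^ (-ε)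

/-- Glue of (D3): the two halves give the critical finite-cluster VOLUME tail in the jump world
(then volume → radius → G1′ → G by the landed equivalences). -/
def ContactGlue : Prop :=
  ContactRichTail → ContactDeficitBound → Jump →
    ∃ κ C : ℝ, 0 < κ ∧ ∀ n : ℕ, 1 ≤ n →
      (bondPercolation (zdGraph 3) (criticalProbI 3)).real (finTail n) ≤ C * (n : ℝ) ^ (-κ)

end Summit.CriticalPhenomena.PercolationContinuityZ3.Cruxes.JumpLineAvoidanceDecay.Strategist
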